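import Literature.NumberTheory.GaloisRepresentations.ContinuousCohomologyConnecting
import Mathlib.CategoryTheory.CofilteredSystem
import HarnessLib

/-!
# Continuous cohomology of an inverse limit of discrete modules, I: the limit representation

Neukirch–Schmidt–Wingberg, *Cohomology of Number Fields* (2nd ed. 2008), II §7 (continuous cochain
cohomology), Thm. (2.7.5) with its corollary: for a profinite group `G` and a countable inverse
system `(A_n)` of finite discrete `G`-modules, the natural map `Hⁱ_cont(G, lim A_n) → lim_n Hⁱ(G, A_n)`
is an isomorphism as soon as the groups `H^{i-1}(G, A_n)` are finite (Mittag-Leffler for the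
`lim¹`-term; J. Tate, *Relations between K₂ and Galois cohomology*, Invent. Math. 36 (1976) §2;
the finite-group analogue is Harari, *Galois cohomology and class field theory* (2017) Prop. 1.31
p. 44 [held: `book:harari2017-galois-cohomology-class-field-theory` p0044]).  NSW itself is not held
in the corpus (locator from the printed table of contents).  This file and its sequel
(`DiscreteModuleInverseLimitH2.lean`) prove the degree-`2` case on Mathlib's `continuousCohomology`,
at the level of the tree's continuous inhomogeneous cocycles (`ContinuousH1.lean`,
`ContinuousH2.lean`), for an arbitrary locally compact `G`.

This first file sets up the objects (definitions with bodies; no named fact, no `sorry`):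

* `DiscreteInvSystem G ι` — an inverse system of DISCRETE topological `G`-modules (the tree's
  jointly continuous `ContinuousRep G ℤ (M n)`) over an index type `ι` with an abstract order
  relation `le` (reflexive, transitive; e.g. `≤` on `ℕ`, divisibility on `ℕ≥1`) and `G`-equivariant
  additive transition maps `red : M m → M n` (`le n m`), functorial;
* `S.limit` — the inverse limit `{x ∈ ∏ M n | red (x m) = x n}` with the subspace topology of the
  product, again a jointly continuous representation `S.limitRep`, with projections `S.projHom n` and
  transition morphisms `S.redHom h` in Mathlib's `TopRep ℤ G`;
* cofinal chains `c : ℕ → ι` and the extension of chain-indexed compatible families to all of `ι`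
  (`exists_extend`);
* continuous sections of surjective transition maps and lifting of continuous cochains
  (`exists_lift`).

Written for the abc-iut cell (layer L4, [AbsTopIII] Cor. 1.10 (i): `H²(G_k, μ_Ẑ(G_k)) ≅ Ẑ` needs
`H²` of the profinite-coefficient cyclotome `μ_Ẑ = lim_n μ_n`), but free of any number theory.
-/

noncomputable section

open CategoryTheory Function

universe v

namespace Literature.NumberTheory.GaloisRepresentations

/-- An **inverse system of discrete topological `G`-modules**: index type `ι` with a reflexive and
transitive relation `le` ("`n` lies below `m`") on the index type of a family of (discrete) topological
`ℤ[G]`-modules `M n` (parameters), jointly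
continuous action `ρ n`, and `G`-equivariant transition homomorphisms `red h : M m →+ M n` for
`le n m`, functorial in `h` (NSW II §7, "projective system of compact/discrete `G`-modules").
[cite: NeukirchSchmidtWingberg2008, II §7 Thm 2.7.5] -/
structure DiscreteInvSystem (G : Type v) [Group G] [TopologicalSpace G] {ι : Type}
    (M : ι → Type v) [∀ n, AddCommGroup (M n)] [∀ n, TopologicalSpace (M n)] where
  /-- the order relation on the indices (`le n m`: level `m` maps to level `n`) -/
  le : ι → ι → Prop
  /-- reflexivity of `le` -/
  le_refl : ∀ n, le n n
  /-- transitivity of `le` -/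
  le_trans : ∀ {a b c : ι}, le a b → le b c → le a c
  /-- the (jointly continuous) actions -/
  ρ : ∀ n, ContinuousRep G ℤ (M n)
  /-- the transition maps -/
  red : ∀ {n m : ι}, le n m → (M m →+ M n)
  /-- the transition maps are equivariant -/
  red_smul : ∀ {n m : ι} (h : le n m) (g : G) (x : M m), red h (ρ m g x) = ρ n g (red h x)
  /-- functoriality: identities -/
  red_refl : ∀ (n : ι) (x : M n), red (le_refl n) x = x
  /-- functoriality: composition -/
  red_trans : ∀ {a b c : ι} (h₁ : le a b) (h₂ : le b c) (x : M c),
    red (le_trans h₁ h₂) x = red h₁ (red h₂ x)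

namespace DiscreteInvSystem

variable {G : Type v} [Group G] [TopologicalSpace G] {ι : Type} {M : ι → Type v}
  [∀ n, AddCommGroup (M n)] [∀ n, TopologicalSpace (M n)] (S : DiscreteInvSystem G M)

/-! ### The inverse limit -/

/-- The **inverse limit** `lim_n M n = {x ∈ ∏ M n | red (x m) = x n for le n m}` as a subgroup
of the product. [cite: NeukirchSchmidtWingberg2008, II §7 Thm 2.7.5] -/
def limit : AddSubgroup (∀ n, M n) where
  carrier := {x | ∀ ⦃n m : ι⦄ (h : S.le n m), S.red h (x m) = x n}
  zero_mem' := fun n m h => by simp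
  add_mem' := fun {x y} hx hy n m h => by
    simp only [Pi.add_apply, map_add, hx h, hy h]
  neg_mem' := fun {x} hx n m h => by
    simp only [Pi.neg_apply, map_neg, hx h]

/-- Membership in the limit: compatibility with all transition maps. [cite: NeukirchSchmidtWingberg2008, II §7 Thm 2.7.5] -/
theorem mem_limit_iff (x : ∀ n, M n) :
    x ∈ S.limit ↔ ∀ ⦃n m : ι⦄ (h : S.le n m), S.red h (x m) = x n :=
  Iff.rfl

/-- Compatibility of the coordinates of an element of the limit. [cite: NeukirchSchmidtWingberg2008, II §7 Thm 2.7.5] -/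
theorem red_apply_coe (x : S.limit) {n m : ι} (h : S.le n m) :
    S.red h ((x : ∀ n, M n) m) = (x : ∀ n, M n) n :=
  x.2 h

/-- The action of `g ∈ G` on the limit (coordinatewise), as an additive homomorphism.
[cite: NeukirchSchmidtWingberg2008, II §7 Thm 2.7.5] -/
def limitAct (g : G) : S.limit →+ S.limit where
  toFun x := ⟨fun n => S.ρ n g ((x : ∀ n, M n) n), fun n m h => by
    rw [S.red_smul, S.red_apply_coe x h]⟩
  map_zero' := Subtype.ext (funext fun n => by simp)
  map_add' x y := Subtype.ext (funext fun n => by simp)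

/-- Coordinates of the action on the limit. [cite: NeukirchSchmidtWingberg2008, II §7 Thm 2.7.5] -/
@[simp] theorem coe_limitAct_apply (g : G) (x : S.limit) (n : ι) :
    (S.limitAct g x : ∀ n, M n) n = S.ρ n g ((x : ∀ n, M n) n) := rfl

/-- The action on the limit as a `ℤ`-linear representation. [cite: NeukirchSchmidtWingberg2008, II §7 Thm 2.7.5] -/
def limitRepr : Representation ℤ G S.limit where
  toFun g := (S.limitAct g).toIntLinearMap
  map_one' := LinearMap.ext fun x => Subtype.ext (funext fun n => by
    simp [AddMonoidHom.toIntLinearMap])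
  map_mul' g h := LinearMap.ext fun x => Subtype.ext (funext fun n => by
    simp [AddMonoidHom.toIntLinearMap, map_mul])

/-- Coordinates of the action on the limit. [cite: NeukirchSchmidtWingberg2008, II §7 Thm 2.7.5] -/
@[simp] theorem coe_limitRepr_apply (g : G) (x : S.limit) (n : ι) :
    (S.limitRepr g x : ∀ n, M n) n = S.ρ n g ((x : ∀ n, M n) n) := rfl

/-- The action on the limit is jointly continuous (coordinatewise joint continuity).
[cite: NeukirchSchmidtWingberg2008, II §7 Thm 2.7.5] -/
theorem continuous_limitRepr : Continuous fun p : G × S.limit => S.limitRepr p.1 p.2 := by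
  refine continuous_induced_rng.2 (continuous_pi fun n => ?_)
  exact (S.ρ n).continuous_apply₂.comp
    (continuous_fst.prodMk ((continuous_apply n).comp (continuous_subtype_val.comp continuous_snd)))

/-- **The inverse limit as a (jointly) continuous representation** of `G` (subspace topology of
`∏ M n`, each `M n` discrete). [cite: NeukirchSchmidtWingberg2008, II §7 Thm 2.7.5] -/
def limitRep : ContinuousRep G ℤ S.limit := ⟨S.limitRepr, S.continuous_limitRepr⟩

/-- Coordinates of the action on the limit. [cite: NeukirchSchmidtWingberg2008, II §7 Thm 2.7.5] -/
@[simp] theorem coe_limitRep_apply (g : G) (x : S.limit) (n : ι) :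
    (S.limitRep g x : ∀ n, M n) n = S.ρ n g ((x : ∀ n, M n) n) := rfl

/-! ### Projections and transition maps as morphisms of topological representations -/

/-- The projection `lim M → M n` as an additive homomorphism. [cite: NeukirchSchmidtWingberg2008, II §7 Thm 2.7.5] -/
def projAddHom (n : ι) : S.limit →+ M n :=
  (Pi.evalAddMonoidHom (fun n => M n) n).comp S.limit.subtype

/-- The projection on elements. [cite: NeukirchSchmidtWingberg2008, II §7 Thm 2.7.5] -/
@[simp] theorem projAddHom_apply (n : ι) (x : S.limit) :
    S.projAddHom n x = (x : ∀ n, M n) n := rfl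

/-- The projection `lim M → M n` is continuous. [cite: NeukirchSchmidtWingberg2008, II §7 Thm 2.7.5] -/
theorem continuous_projAddHom (n : ι) : Continuous (S.projAddHom n) :=
  (continuous_apply n).comp continuous_subtype_val

section Morphisms

variable [∀ n, DiscreteTopology (M n)]

/-- **The projection `lim_n M n ⟶ M n`** in Mathlib's `TopRep ℤ G`. [cite: NeukirchSchmidtWingberg2008, II §7 Thm 2.7.5] -/
def projHom (n : ι) : S.limitRep.toTopRep ⟶ (S.ρ n).toTopRep :=
  TopRep.ofHom ⟨⟨(S.projAddHom n).toIntLinearMap, S.continuous_projAddHom n⟩, fun σ => by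
    ext x; rfl⟩

/-- The projection morphism on elements. [cite: NeukirchSchmidtWingberg2008, II §7 Thm 2.7.5] -/
@[simp] theorem projHom_hom_apply (n : ι) (x : S.limit) :
    (S.projHom n).hom x = (x : ∀ n, M n) n := rfl

/-- **The transition map `M m ⟶ M n`** (`le n m`) in Mathlib's `TopRep ℤ G` (continuous as a map
out of a discrete space). [cite: NeukirchSchmidtWingberg2008, II §7 Thm 2.7.5] -/
def redHom {n m : ι} (h : S.le n m) : (S.ρ m).toTopRep ⟶ (S.ρ n).toTopRep :=
  TopRep.ofHom ⟨⟨(S.red h).toIntLinearMap, continuous_of_discreteTopology⟩, fun σ => by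
    ext x; exact S.red_smul h σ x⟩

/-- The transition morphism on elements. [cite: NeukirchSchmidtWingberg2008, II §7 Thm 2.7.5] -/
@[simp] theorem redHom_hom_apply {n m : ι} (h : S.le n m) (x : M m) :
    (S.redHom h).hom x = S.red h x := rfl

end Morphisms

/-- Proof-irrelevance of the transition maps in the order witness. [cite: NeukirchSchmidtWingberg2008, II §7 Thm 2.7.5] -/
theorem red_congr {n m : ι} (h h' : S.le n m) (x : M m) : S.red h x = S.red h' x := rfl

/-! ### Cofinal chains -/

/-- A **cofinal chain** in the index type: `c 0 ≤ c 1 ≤ ⋯` with every index below some `c i`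
(e.g. `i ↦ i` in `ℕ`, `i ↦ (i+1)!` in `ℕ≥1` ordered by divisibility). [cite: NeukirchSchmidtWingberg2008, II §7 Thm 2.7.5] -/
structure CofinalChain where
  /-- the chain -/
  seq : ℕ → ι
  /-- successive terms are comparable -/
  le_succ : ∀ i, S.le (seq i) (seq (i + 1))
  /-- cofinality -/
  cofinal : ∀ n, ∃ i, S.le n (seq i)

variable {S}

namespace CofinalChain

variable (c : S.CofinalChain)

/-- Terms of a cofinal chain are comparable along `≤` in `ℕ`. [cite: NeukirchSchmidtWingberg2008, II §7 Thm 2.7.5] -/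
theorem le_of_le {i j : ℕ} (hij : i ≤ j) : S.le (c.seq i) (c.seq j) := by
  induction hij with
  | refl => exact S.le_refl _
  | step _ ih => exact S.le_trans ih (c.le_succ _)

/-- A chosen chain index dominating `n`. [cite: NeukirchSchmidtWingberg2008, II §7 Thm 2.7.5] -/
def idx (n : ι) : ℕ := (c.cofinal n).choose

/-- The chosen chain index dominates `n`. [cite: NeukirchSchmidtWingberg2008, II §7 Thm 2.7.5] -/
theorem le_idx (n : ι) : S.le n (c.seq (c.idx n)) := (c.cofinal n).choose_spec

end CofinalChain

/-! ### Extending chain-compatible families to the whole index type -/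

section Extend

variable (c : S.CofinalChain) {β : ι → Type*} (r : ∀ {n m : ι}, S.le n m → β m → β n)
  (hr_refl : ∀ n (x : β n), r (S.le_refl n) x = x)
  (hr_trans : ∀ {a b d : ι} (h₁ : S.le a b) (h₂ : S.le b d) (x : β d),
    r (S.le_trans h₁ h₂) x = r h₁ (r h₂ x))

include hr_refl hr_trans in
/-- A family compatible along successive terms of the chain is compatible along the whole chain.
[cite: NeukirchSchmidtWingberg2008, II §7 Thm 2.7.5] -/
theorem chain_compat (y : ∀ i, β (c.seq i)) (hy : ∀ i, r (c.le_succ i) (y (i + 1)) = y i)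
    {i j : ℕ} (hij : i ≤ j) : r (c.le_of_le hij) (y j) = y i := by
  induction hij with
  | refl => exact hr_refl _ _
  | step hle ih =>
    rename_i j
    have h := hr_trans (c.le_of_le hle) (c.le_succ j) (y (j + 1))
    rw [hy j] at h
    rw [← ih, ← h]

include hr_refl hr_trans in
/-- **Extension of a chain-compatible family to all indices**: `z n := r (y (idx n))`; the result is
compatible for every pair `le n m` and restricts to `y` on the chain. [cite: NeukirchSchmidtWingberg2008, II §7 Thm 2.7.5] -/
theorem exists_extend (y : ∀ i, β (c.seq i)) (hy : ∀ i, r (c.le_succ i) (y (i + 1)) = y i) :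
    ∃ z : ∀ n, β n, (∀ {n m : ι} (h : S.le n m), r h (z m) = z n) ∧
      ∀ i, z (c.seq i) = y i := by
  have hyc : ∀ {i j : ℕ} (hij : i ≤ j), r (c.le_of_le hij) (y j) = y i := fun hij =>
    S.chain_compat c r hr_refl hr_trans y hy hij
  -- value at `n` read off at any dominating chain index
  have hindep : ∀ (n : ι) (i j : ℕ) (hi : S.le n (c.seq i)) (hj : S.le n (c.seq j)),
      r hi (y i) = r hj (y j) := by
    intro n i j hi hj
    wlog hij : i ≤ j generalizing i j
    · exact (this j i hj hi (le_of_not_ge hij)).symm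
    rw [← hyc hij, ← hr_trans]
  refine ⟨fun n => r (c.le_idx n) (y (c.idx n)), fun {n m} h => ?_, fun i => ?_⟩
  · -- compatibility: compare at the larger of the two chosen chain indices
    change r h (r (c.le_idx m) (y (c.idx m))) = r (c.le_idx n) (y (c.idx n))
    have hm : S.le m (c.seq (max (c.idx n) (c.idx m))) :=
      S.le_trans (c.le_idx m) (c.le_of_le (le_max_right _ _))
    rw [hindep m (c.idx m) _ (c.le_idx m) hm, ← hr_trans,
      hindep n (c.idx n) _ (c.le_idx n) (S.le_trans h hm)]
  · change r (c.le_idx (c.seq i)) (y (c.idx (c.seq i))) = y i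
    rw [hindep (c.seq i) (c.idx (c.seq i)) i (c.le_idx (c.seq i)) (S.le_refl _), hr_refl]

end Extend

/-! ### Continuous sections and lifts along the transition maps -/

section Sections

variable [∀ n, DiscreteTopology (M n)]

/-- A surjective transition map between discrete modules has a CONTINUOUS section.
[cite: NeukirchSchmidtWingberg2008, II §7 Thm 2.7.5] -/
theorem exists_continuous_section {n m : ι} (h : S.le n m) (hs : Surjective (S.red h)) :
    ∃ s : C(M n, M m), ∀ x, S.red h (s x) = x :=
  ⟨⟨surjInv hs, continuous_of_discreteTopology⟩, surjInv_eq hs⟩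

/-- **Lifting continuous cochains**: a continuous map `b : T → M n` lifts along a surjective
transition map to a continuous `b' : T → M m`. [cite: NeukirchSchmidtWingberg2008, II §7 Thm 2.7.5] -/
theorem exists_lift {T : Type*} [TopologicalSpace T] {n m : ι} (h : S.le n m)
    (hs : Surjective (S.red h)) (b : C(T, M n)) :
    ∃ b' : C(T, M m), ∀ t, S.red h (b' t) = b t := by
  obtain ⟨s, hsec⟩ := S.exists_continuous_section h hs
  exact ⟨s.comp b, fun t => hsec (b t)⟩

end Sections

end DiscreteInvSystem

end Literature.NumberTheory.GaloisRepresentations
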